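import Summits.Ventures.YMGap.Thresholds.CouplingSmooth
import Summits.Ventures.YMGap.Thresholds.PressureDerivative
import Summits.Ventures.YMGap.Thresholds.CouplingDerivativeClosed
import Summits.Ventures.YMGap.Thresholds.PressureZeroCoupling
import HarnessLib

/-!
# Venture YMGap — C-SMOOTH (iv): AT `β = 0` THE TRUNCATED FUNCTIONS ARE SUPPORTED ON LINKED CLUSTERS — every
# strong-coupling coefficient is a FINITE sum of `β = 0` cumulants over plaquette tuples in a box (`SU(2)`, `d = 4`)

HONEST FRAMING: venture file of the cell `pub-ymgap` (QuantumFields programme), seat ds-1 (gen 12).  Exact `β = 0`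
lattice statements for `SU(2)` Wilson lattice gauge theory on `ℤ⁴` (the `β = 0` DLR state is the product Haar measure
`dg_∞`, g9 `su2_eq_zdHaar_of_mem_zero`): the `β = 0` joint cumulants `u_{n+1}(F; W_{q 0}; …)` of a local observable
and plaquette energies vanish unless the plaquettes form a chain linked to `F`, so their sum over ALL plaquette tuples is a
FINITE box sum (the lattice-animal structure of the strong-coupling expansion, as a kernel theorem). The sequel
`ZeroCouplingClustersCoefficients` combines this with the closed-window calculus of `PressureSmooth`
(`su2_iteratedDerivWithin_integral_zero`) to identify the Balian–Drouffe–Itzykson coefficients of `⟨F⟩` — the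
right-derivatives at `β_W = 0` — with these finite box sums. Their VALUES are not computed here (g9–g11 computed the
pressure jet to order 4); nothing about `β > 0`, nothing about the continuum or the Clay problem.

* `slotSupp`, `slot_cylinder` — the slots of `(F; W_{q 0}; …)` are Lipschitz cylinders on their EXACT supports `Λ`,
  `plaquetteEdges (q j)`;
* ★ `trunc_zdHaar_eq_zero_of_disjoint` — under `dg_∞`, if a cut of the slots (`F` on the low side) separates the link
  supports DISJOINTLY, the truncated function vanishes: independent blocks have no mixed cumulants
  (`integral_zdHaar_mul_eq_of_dependsOn` ⇒ exact factorisation of every moment ⇒ `ac_eq_zero_of_factor`);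
* `slotSupp`, ★★ `trunc_zdHaar_eq_zero_of_not_connected` — THE LATTICE-ANIMAL RULE: if some plaquette slot is not
  connected to the slot of `F` through a chain of link-sharing supports, `u_{n+1}|_{β=0} = 0` (cut = the connected
  component of `F`);
* ★★ `trunc_zdHaar_eq_zero_of_far` — hence `u_{n+1}(F; W_{q 0}; …; W_{q (n−1)})|_{β=0} = 0` as soon as ONE plaquette
  `q j` has `‖x_{q j} − x₀‖_∞ ≥ D + 2n + 2` (pigeonhole `exists_gap` among the excess distances: a gap of length `≥ 3`
  separates the link sets);
* `plaquetteBox`, `mem_plaquetteBox` — the finite set of plaquettes based in the sup-norm cube of radius `M` about `x₀`;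
* ★★ `tsum_trunc_zdHaar_eq_sum_box` — `Σ'_{q} u_{n+1}(F; W_q…)|_{β=0} = Σ_{q ∈ Box(D+2n+1)^n} u_{n+1}(F; W_q…)|_{β=0}`;

References (mechanism only): R. Balian, J.-M. Drouffe, C. Itzykson, PRD 11 (1975) 2104; K. Osterwalder, E. Seiler,
Ann. Phys. 110 (1978) 440, §2; B. Simon, *The Statistical Mechanics of Lattice Gases* I (1993), §II.12.
-/

noncomputable section

open MeasureTheory ProbabilityTheory Function Finset Filter Topology Real Set
open scoped NNReal ContDiff
open Literature.MathematicalPhysics.QuantumLattice (LGConfig ZdEdge ZdPlaquette plaquetteEdges fundamentalRep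
  ymGibbsMeasures)
open Literature.MathematicalPhysics.QuantumFieldTheory hiding ZdEdge
open Literature.Probability.LatticeModels (Site Site.supNorm Site.norm_eq_supNorm Site.supNorm_le_iff)
open Summit.Ventures.YMGap.RobustBall (l1 numOrient)
open Summit.Ventures.YMGap.Cumulants
open Summit.Ventures.YMGap.PressureRegularity (su2_eq_zdHaar_of_mem_zero)

namespace Summit.Ventures.YMGap.CouplingResponse

/-- Local shorthand: the normalised plaquette observable `W_q = ½ Re tr U_q` of `SU(2)` on `ℤ⁴`, as a family. -/
local notation3 (prettyPrint := false) "𝓦" =>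
  fun q : ZdPlaquette 4 => zdPlaquetteObs (d := 4) (fundamentalRep (Fin 2)) (Prod.fst q) (Prod.snd q).1.1 (Prod.snd q).1.2

/-! ### §1 Exact supports of the slots; exact factorisation under `dg_∞`; vanishing across a disjoint cut -/

/-- **The exact link support of a slot** of `(F; W_{q 0}; …; W_{q (n−1)})`: `Λ` for slot `0`, `plaquetteEdges (q j)`
for slot `j + 1` (`j < n`), `∅` beyond. -/
def slotSupp (Λ : Finset (ZdEdge 4)) {n : ℕ} (q : Fin n → ZdPlaquette 4) : ℕ → Finset (ZdEdge 4)
  | 0 => Λ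
  | j + 1 => if h : j < n then plaquetteEdges (q ⟨j, h⟩) else ∅

/-- `slotSupp` of a plaquette slot. -/
theorem slotSupp_succ (Λ : Finset (ZdEdge 4)) {n : ℕ} (q : Fin n → ZdPlaquette 4) (j : Fin n) :
    slotSupp Λ q (j.1 + 1) = plaquetteEdges (q j) := by
  simp [slotSupp, j.2]

/-- `slotSupp` of a junk slot. -/
theorem slotSupp_of_le (Λ : Finset (ZdEdge 4)) {n : ℕ} (q : Fin n → ZdPlaquette 4) {j : ℕ} (hj : n ≤ j) :
    slotSupp Λ q (j + 1) = ∅ := by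
  simp [slotSupp, not_lt.2 hj]

/-- **The slots on their exact supports**: slot `0` is `F` on `Λ`, slot `j + 1` (`j < n`) is `W_{q j}` on
`plaquetteEdges (q j)`, the junk slots are the constant `1` on `∅`; all with constant `K + 4·2³` and bound
`|F 1| + 2K + 1`. -/
theorem slot_cylinder {F : LGConfig 4 (Matrix.specialUnitaryGroup (Fin 2) ℂ) → ℝ} {Λ : Finset (ZdEdge 4)} {K : ℝ≥0}
    (hF : IsLipschitzCylinder (fundamentalRep (Fin 2)) F Λ K) {n : ℕ} (q : Fin n → ZdPlaquette 4) (i : ℕ) :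
    IsLipschitzCylinder (fundamentalRep (Fin 2)) (slots F 𝓦 q i) (slotSupp Λ q i) (K + 4 * 2 ^ 3) ∧
      ∀ U, |slots F 𝓦 q i U| ≤ ((‖F 1‖₊ + 2 * K + 1 : ℝ≥0) : ℝ) := by
  classical
  have hB : ((‖F 1‖₊ + 2 * K + 1 : ℝ≥0) : ℝ) = |F 1| + 2 * K + 1 := by
    push_cast; rw [Real.norm_eq_abs]
  have hK : (0 : ℝ) ≤ K := K.2
  rcases i with _ | j
  · refine ⟨?_, fun U => ?_⟩
    · simpa [slotSupp] using ZdSmoothing.isLipschitzCylinder_mono hF (show K ≤ K + 4 * 2 ^ 3 from le_self_add)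
    · rw [hB, slots_zero]; linarith [hF.abs_le U]
  · by_cases hj : j < n
    · obtain ⟨hW, -, hW1, -, -⟩ := su2_plaquetteObs_data (q ⟨j, hj⟩)
      refine ⟨?_, fun U => ?_⟩
      · rw [slotSupp_succ Λ q ⟨j, hj⟩, slots_succ_of_lt _ _ _ hj]
        exact ZdSmoothing.isLipschitzCylinder_mono hW (by rw [add_comm]; exact le_self_add)
      · rw [slots_succ_of_lt _ _ _ hj, hB]
        have := hW1 U
        push_cast at this
        linarith [abs_nonneg (F 1)]
    · refine ⟨?_, fun U => ?_⟩
      · rw [slotSupp_of_le Λ q (not_lt.1 hj), slots_succ_of_le _ _ _ (not_lt.1 hj)]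
        exact ZdSmoothing.isLipschitzCylinder_of_dist_le fun U V => by
          simp only [sub_self, abs_zero]; positivity
      · rw [slots_succ_of_le _ _ _ (not_lt.1 hj), hB]
        simp only [abs_one]
        linarith [abs_nonneg (F 1)]

/-- ★ **INDEPENDENT BLOCKS HAVE NO MIXED CUMULANTS at `β = 0`**: under the product Haar measure `dg_∞`, if a cut `p` of
the slots with `F` on the low side (`p 0`) and some plaquette on the high side has the LINK SUPPORTS of the two sides
DISJOINT, then `u_{n+1}(F; W_{q 0}; …; W_{q (n−1)}) = 0` — every moment factorises exactly
(`integral_zdHaar_mul_eq_of_dependsOn`), so the anchored cumulant vanishes (`ac_eq_zero_of_factor`). -/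
theorem trunc_zdHaar_eq_zero_of_disjoint {F : LGConfig 4 (Matrix.specialUnitaryGroup (Fin 2) ℂ) → ℝ}
    {Λ : Finset (ZdEdge 4)} {K : ℝ≥0} (hF : IsLipschitzCylinder (fundamentalRep (Fin 2)) F Λ K)
    {n : ℕ} (q : Fin n → ZdPlaquette 4) (p : ℕ → Prop) [DecidablePred p] (hp0 : p 0) {j₀ : Fin n}
    (hj₀ : ¬p (j₀.1 + 1))
    (hdisj0 : ∀ j : Fin n, ¬p (j.1 + 1) → Disjoint Λ (plaquetteEdges (q j)))
    (hdisj : ∀ i j : Fin n, p (i.1 + 1) → ¬p (j.1 + 1) → Disjoint (plaquetteEdges (q i)) (plaquetteEdges (q j))) :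
    trunc (zdHaar 4 (Matrix.specialUnitaryGroup (Fin 2) ℂ)) F 𝓦 q = 0 := by
  classical
  haveI : IsProbabilityMeasure (zdHaar 4 (Matrix.specialUnitaryGroup (Fin 2) ℂ)) := by
    unfold zdHaar; infer_instance
  set Λs : ℕ → Finset (ZdEdge 4) := slotSupp Λ q with hΛs
  set X := slots F 𝓦 q with hX
  set S : Finset ℕ := Finset.range (n + 1) with hS
  have hB1 : (1 : ℝ≥0) ≤ ‖F 1‖₊ + 2 * K + 1 := le_add_self
  have hcyl : ∀ i, IsLipschitzCylinder (fundamentalRep (Fin 2)) (X i) (Λs i) (K + 4 * 2 ^ 3) := fun i =>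
    (slot_cylinder hF q i).1
  have hbd : ∀ i, ∀ U, |X i U| ≤ ((‖F 1‖₊ + 2 * K + 1 : ℝ≥0) : ℝ) := fun i => (slot_cylinder hF q i).2
  -- the supports of the two sides are disjoint
  have hΛs_succ : ∀ j : Fin n, Λs (j.1 + 1) = plaquetteEdges (q j) := fun j => slotSupp_succ Λ q j
  have hΛs_junk : ∀ j, n ≤ j → Λs (j + 1) = ∅ := fun j hj => slotSupp_of_le Λ q hj
  have hpair : ∀ i j : ℕ, p i → ¬p j → Disjoint (Λs i) (Λs j) := by
    intro i j hpi hpj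
    rcases j with _ | j'
    · exact absurd hp0 hpj
    · by_cases hj' : j' < n
      · rw [hΛs_succ ⟨j', hj'⟩]
        rcases i with _ | i'
        · exact hdisj0 ⟨j', hj'⟩ hpj
        · by_cases hi' : i' < n
          · rw [hΛs_succ ⟨i', hi'⟩]; exact hdisj ⟨i', hi'⟩ ⟨j', hj'⟩ hpi hpj
          · rw [hΛs_junk i' (not_lt.1 hi')]; exact Finset.disjoint_empty_left _
      · rw [hΛs_junk j' (not_lt.1 hj')]; exact Finset.disjoint_empty_right _
  -- exact factorisation of every moment across the cut
  have hM : ∀ T ⊆ S, mom (zdHaar 4 (Matrix.specialUnitaryGroup (Fin 2) ℂ)) X T =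
      mom (zdHaar 4 _) X (T.filter p) * mom (zdHaar 4 _) X (T.filter fun i => ¬p i) := by
    intro T _
    obtain ⟨hLp, -⟩ := isLipschitzCylinder_prod hB1 (T.filter p) (fun i _ => hcyl i) (fun i _ => hbd i)
    obtain ⟨hLn, -⟩ := isLipschitzCylinder_prod hB1 (T.filter fun i => ¬p i) (fun i _ => hcyl i) (fun i _ => hbd i)
    have hdj : Disjoint ((T.filter p).biUnion Λs) ((T.filter fun i => ¬p i).biUnion Λs) := by
      rw [Finset.disjoint_biUnion_left]
      intro i hi
      rw [Finset.disjoint_biUnion_right]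
      intro j hj
      exact hpair i j (Finset.mem_filter.1 hi).2 (Finset.mem_filter.1 hj).2
    have key := Literature.Probability.LatticeModels.integral_mul_eq_of_dependsOn_disjoint
      (fun _ : ZdEdge 4 => haarProbability (Matrix.specialUnitaryGroup (Fin 2) ℂ)) hdj hLp.measurable hLn.measurable
      hLp.dependsOn hLn.dependsOn
    simp only [mom, zdHaar] at key ⊢
    rw [← key]
    refine integral_congr_ae (ae_of_all _ fun U => ?_)
    exact (Finset.prod_filter_mul_prod_filter_not T p (fun i => X i U)).symm
  have h0S : (0 : ℕ) ∈ S := Finset.mem_range.2 (Nat.succ_pos n)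
  have hSn : (S.filter fun i => ¬p i).Nonempty :=
    ⟨j₀.1 + 1, Finset.mem_filter.2 ⟨Finset.mem_range.2 (by have := j₀.2; omega), hj₀⟩⟩
  exact ac_eq_zero_of_factor p (mom_empty _ X) hM hp0 S subset_rfl h0S hSn

/-- ★★ **THE LATTICE-ANIMAL RULE at `β = 0`**: if some plaquette slot `j + 1` is NOT connected to the slot of `F` through a
chain of slots with pairwise link-sharing supports (`Relation.ReflTransGen (¬Disjoint (slotSupp …) (slotSupp …)) 0 (j+1)`
fails), then
`u_{n+1}(F; W_{q 0}; …; W_{q (n−1)})|_{dg_∞} = 0` — only plaquette tuples forming a cluster LINKED TO `supp F` contribute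
to the strong-coupling coefficients (cut = the connected component of the slot of `F`; `trunc_zdHaar_eq_zero_of_disjoint`). -/
theorem trunc_zdHaar_eq_zero_of_not_connected {F : LGConfig 4 (Matrix.specialUnitaryGroup (Fin 2) ℂ) → ℝ}
    {Λ : Finset (ZdEdge 4)} {K : ℝ≥0} (hF : IsLipschitzCylinder (fundamentalRep (Fin 2)) F Λ K)
    {n : ℕ} (q : Fin n → ZdPlaquette 4) {j₀ : Fin n}
    (hj₀ : ¬Relation.ReflTransGen (fun i k => ¬Disjoint (slotSupp Λ q i) (slotSupp Λ q k)) 0 (j₀.1 + 1)) :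
    trunc (zdHaar 4 (Matrix.specialUnitaryGroup (Fin 2) ℂ)) F 𝓦 q = 0 := by
  classical
  let p : ℕ → Prop := fun i => Relation.ReflTransGen (fun i k => ¬Disjoint (slotSupp Λ q i) (slotSupp Λ q k)) 0 i
  have hp0 : p 0 := Relation.ReflTransGen.refl
  -- connected-to-`F` slots and the others have disjoint supports (else the other would be connected too)
  have hstep : ∀ i k : ℕ, p i → ¬p k → Disjoint (slotSupp Λ q i) (slotSupp Λ q k) := fun i k hi hk => by
    by_contra hadj
    exact hk (Relation.ReflTransGen.tail hi hadj)
  refine trunc_zdHaar_eq_zero_of_disjoint hF q p hp0 (j₀ := j₀) hj₀ (fun j hj => ?_) (fun i j hi hj => ?_)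
  · have h := hstep 0 (j.1 + 1) hp0 hj
    rwa [slotSupp_succ] at h
  · have h := hstep (i.1 + 1) (j.1 + 1) hi hj
    rwa [slotSupp_succ, slotSupp_succ] at h

/-! ### §2 One far plaquette kills the `β = 0` cumulant -/

/-- ★★ **ONE FAR PLAQUETTE KILLS THE `β = 0` TRUNCATED FUNCTION**: if the links of `F` are based within `D` of `x₀` and
some plaquette of the tuple has `‖x_{q j} − x₀‖_∞ ≥ D + 2n + 2`, then `u_{n+1}(F; W_{q 0}; …; W_{q (n−1)})|_{dg_∞} = 0`
(pigeonhole `exists_gap` among the excess distances `(‖x_{q i} − x₀‖_∞ − (D+1))₊`: a gap of length `≥ 3` makes the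
link sets of the two sides disjoint; then `trunc_zdHaar_eq_zero_of_disjoint`). -/
theorem trunc_zdHaar_eq_zero_of_far {F : LGConfig 4 (Matrix.specialUnitaryGroup (Fin 2) ℂ) → ℝ}
    {Λ : Finset (ZdEdge 4)} {K : ℝ≥0} (hF : IsLipschitzCylinder (fundamentalRep (Fin 2)) F Λ K)
    {x₀ : Site 4} {D : ℕ} (hD : ∀ e ∈ Λ, ‖e.1 - x₀‖ ≤ D) {n : ℕ} (q : Fin n → ZdPlaquette 4)
    {j : Fin n} (hj : D + 2 * n + 2 ≤ Site.supNorm ((q j).1 - x₀)) :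
    trunc (zdHaar 4 (Matrix.specialUnitaryGroup (Fin 2) ℂ)) F 𝓦 q = 0 := by
  classical
  -- excess distances beyond the reach of `F`
  set d : Fin n → ℕ := fun i => Site.supNorm ((q i).1 - x₀) - (D + 1) with hd
  have hne : (Finset.univ : Finset (Fin n)).Nonempty := ⟨j, Finset.mem_univ _⟩
  set R : ℕ := Finset.univ.sup d with hR
  have hdR : ∀ i, d i ≤ R := fun i => Finset.le_sup (f := d) (Finset.mem_univ i)
  obtain ⟨i₀, -, hi₀⟩ := Finset.exists_mem_eq_sup Finset.univ hne d
  have hRj : 2 * n + 1 ≤ R := by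
    have h1 : 2 * n + 1 ≤ d j := by simp only [hd]; omega
    exact h1.trans (hdR j)
  have hRpos : 0 < R := by omega
  obtain ⟨u, v, huv, hvR, hgap, hall⟩ := exists_gap d hdR ⟨i₀, hi₀.symm⟩ hRpos
  have hvu : u + 3 ≤ v := by
    by_contra h
    have : v - u ≤ 2 := by omega
    have := Nat.mul_le_mul_left n this
    omega
  -- the cut
  let p : ℕ → Prop := fun i => i = 0 ∨ ∃ k : Fin n, i = k.1 + 1 ∧ d k ≤ u
  have hp0 : p 0 := Or.inl rfl
  have hpk : ∀ k : Fin n, p (k.1 + 1) ↔ d k ≤ u := fun k => by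
    constructor
    · rintro (h | ⟨k', hk', hdk'⟩)
      · exact absurd h (Nat.succ_ne_zero _)
      · have : k = k' := Fin.ext (by omega)
        rw [this]; exact hdk'
    · exact fun h => Or.inr ⟨k, rfl, h⟩
  have hhigh : ∀ k : Fin n, ¬p (k.1 + 1) → v ≤ d k := fun k hk =>
    (hall k).resolve_left (fun h => hk ((hpk k).2 h))
  -- link base points: LOW side within `u + D + 2` of `x₀`, HIGH side at least `v + D` away
  have hlowF : ∀ e ∈ Λ, ‖e.1 - x₀‖ ≤ (u : ℝ) + D + 2 := fun e he =>
    (hD e he).trans (by have : (0:ℝ) ≤ u := Nat.cast_nonneg _; linarith)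
  have hplaq : ∀ (k : Fin n), ∀ e ∈ plaquetteEdges (q k),
      |‖e.1 - x₀‖ - (Site.supNorm ((q k).1 - x₀) : ℝ)| ≤ 1 := by
    intro k e he
    have h1 : ‖e.1 - (q k).1‖ ≤ 1 := norm_fst_sub_le_of_mem_plaquetteEdges he
    have h2 : ‖(q k).1 - x₀‖ = (Site.supNorm ((q k).1 - x₀) : ℝ) := Site.norm_eq_supNorm _
    rw [abs_le]
    constructor
    · have : ‖(q k).1 - x₀‖ ≤ ‖e.1 - x₀‖ + ‖e.1 - (q k).1‖ := by
        calc ‖(q k).1 - x₀‖ = ‖(e.1 - x₀) - (e.1 - (q k).1)‖ := by congr 1; abel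
          _ ≤ _ := norm_sub_le _ _
      linarith
    · have : ‖e.1 - x₀‖ ≤ ‖e.1 - (q k).1‖ + ‖(q k).1 - x₀‖ := by
        calc ‖e.1 - x₀‖ = ‖(e.1 - (q k).1) + ((q k).1 - x₀)‖ := by congr 1; abel
          _ ≤ _ := norm_add_le _ _
      linarith
  have hlowP : ∀ k : Fin n, d k ≤ u → ∀ e ∈ plaquetteEdges (q k), ‖e.1 - x₀‖ ≤ (u : ℝ) + D + 2 := by
    intro k hk e he
    have h := (abs_le.1 (hplaq k e he)).2
    have hdk : (Site.supNorm ((q k).1 - x₀) : ℝ) ≤ u + D + 1 := by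
      have : Site.supNorm ((q k).1 - x₀) ≤ u + (D + 1) := by simp only [hd] at hk; omega
      exact_mod_cast (by omega : Site.supNorm ((q k).1 - x₀) ≤ u + D + 1)
    linarith
  have hhighP : ∀ k : Fin n, v ≤ d k → ∀ e ∈ plaquetteEdges (q k), (v : ℝ) + D ≤ ‖e.1 - x₀‖ := by
    intro k hk e he
    have h := (abs_le.1 (hplaq k e he)).1
    have hdk : (v : ℝ) + D + 1 ≤ Site.supNorm ((q k).1 - x₀) := by
      have hv0 : 0 < v := by omega
      have : v + (D + 1) ≤ Site.supNorm ((q k).1 - x₀) := by simp only [hd] at hk; omega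
      exact_mod_cast (by omega : v + D + 1 ≤ Site.supNorm ((q k).1 - x₀))
    linarith
  have hsep : ∀ {A B : Finset (ZdEdge 4)}, (∀ e ∈ A, ‖e.1 - x₀‖ ≤ (u : ℝ) + D + 2) →
      (∀ e ∈ B, (v : ℝ) + D ≤ ‖e.1 - x₀‖) → Disjoint A B := by
    intro A B hA hB
    rw [Finset.disjoint_left]
    intro e heA heB
    have h1 := hA e heA
    have h2 := hB e heB
    have h3 : (u : ℝ) + 3 ≤ v := by exact_mod_cast hvu
    linarith
  refine trunc_zdHaar_eq_zero_of_disjoint hF q p hp0 (j₀ := i₀) ?_ (fun k hk => hsep hlowF (hhighP k (hhigh k hk)))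
    (fun i k hi hk => hsep (hlowP i ((hpk i).1 hi)) (hhighP k (hhigh k hk)))
  -- the maximal plaquette is on the high side
  intro h
  have := (hpk i₀).1 h
  omega

/-! ### §3 The box of plaquettes; the `β = 0` response series is a finite sum -/

/-- The plaquettes of `ℤ⁴` based in the sup-norm cube of radius `M` about `x₀` (a finite set). -/
def plaquetteBox (x₀ : Site 4) (M : ℕ) : Finset (ZdPlaquette 4) :=
  (Fintype.piFinset fun k : Fin 4 => Finset.Icc (x₀ k - M) (x₀ k + M)) ×ˢ Finset.univ

/-- Membership in the box: `‖x_p − x₀‖_∞ ≤ M`. -/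
theorem mem_plaquetteBox {x₀ : Site 4} {M : ℕ} {p : ZdPlaquette 4} :
    p ∈ plaquetteBox x₀ M ↔ Site.supNorm (p.1 - x₀) ≤ M := by
  rw [plaquetteBox, Finset.mem_product, Fintype.mem_piFinset, Site.supNorm_le_iff]
  simp only [Finset.mem_univ, and_true, Finset.mem_Icc, Pi.sub_apply]
  refine forall_congr' fun k => ?_
  rw [← Int.ofNat_le, Int.natCast_natAbs, abs_le]
  constructor
  · rintro ⟨h1, h2⟩; constructor <;> linarith
  · rintro ⟨h1, h2⟩; constructor <;> linarith

/-- ★★ **THE `β = 0` RESPONSE SERIES OF EVERY ORDER IS A FINITE BOX SUM**: with `F` supported within `D` of `x₀`,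
`Σ'_{q : Fin n → plaquettes} u_{n+1}(F; W_{q 0}; …)|_{dg_∞} = Σ_{q : Fin n → Box(x₀, D+2n+1)} u_{n+1}(F; W_{q 0}; …)|_{dg_∞}`
(tuples with a plaquette outside the box contribute zero, `trunc_zdHaar_eq_zero_of_far`). -/
theorem tsum_trunc_zdHaar_eq_sum_box {F : LGConfig 4 (Matrix.specialUnitaryGroup (Fin 2) ℂ) → ℝ}
    {Λ : Finset (ZdEdge 4)} {K : ℝ≥0} (hF : IsLipschitzCylinder (fundamentalRep (Fin 2)) F Λ K)
    {x₀ : Site 4} {D : ℕ} (hD : ∀ e ∈ Λ, ‖e.1 - x₀‖ ≤ D) (n : ℕ) :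
    ∑' q : Fin n → ZdPlaquette 4, trunc (zdHaar 4 (Matrix.specialUnitaryGroup (Fin 2) ℂ)) F 𝓦 q =
      ∑ q ∈ Fintype.piFinset (fun _ : Fin n => plaquetteBox x₀ (D + 2 * n + 1)),
        trunc (zdHaar 4 (Matrix.specialUnitaryGroup (Fin 2) ℂ)) F 𝓦 q := by
  classical
  refine tsum_eq_sum fun q hq => ?_
  rw [Fintype.mem_piFinset] at hq
  obtain ⟨j, hj⟩ := not_forall.1 hq
  rw [mem_plaquetteBox, not_le] at hj
  exact trunc_zdHaar_eq_zero_of_far hF hD q (j := j) (by omega)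

end Summit.Ventures.YMGap.CouplingResponse

end
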